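import Literature.NumberTheory.EllipticCurves.PastenHeightBounds
import Literature.NumberTheory.EllipticCurves.RationalIsogenyDegrees
import Literature.NumberTheory.EllipticCurves.IsogenyPeriodLatticeProofs
import Literature.NumberTheory.EllipticCurves.IsogenyDualProofs
import Literature.NumberTheory.EllipticCurves.IsogenyCanonicalHeightProofs
import Literature.NumberTheory.EllipticCurves.NeronIsogenyScaling
import HarnessLib

/-!
# `|h(E) − h(E')| ≤ ½ log 163` in a `ℚ`-isogeny class: the proof of Pasten 2024, §3 / Lemma 6.8,
# reduced to Mazur–Kenku and the integrality of Néron multipliers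

Topic `NumberTheory/EllipticCurves`; a proofs-only sibling of `PastenHeightBounds.lean` (theorems
only: no definitions, no named facts) serving the named fact
`Literature.NumberTheory.EllipticCurves.ModularForms.abs_neronLatticeHeight_sub_le_of_isIsogenous`
(`|h(E) − h(E')| ≤ ½ log 163` for `ℚ`-isogenous elliptic curves, `h = neronLatticeHeight` of the
Néron lattices of global minimal models; Pasten 2024, §3 p. 13 and the proof of Lemma 6.8).

## The printed proof and what is proved here

Pasten (§3, p. 13; Lemma 6.8, proof): "The degree of a minimal isogeny between `A` and `E` is
uniformly bounded by `163` thanks to Mazur and Kenku, so Lemma 5 in [Faltings] gives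
`|h(A) − h(E)| ≤ ½ log 163`." The two ingredients are

1. **Mazur–Kenku**: two `ℚ`-isogenous elliptic curves over `ℚ` are joined by a `ℚ`-isogeny of
   degree `≤ 163` — the tree's named fact `mazurKenku_exists_cyclic_isogeny`
   (`RationalIsogenyDegrees.lean`, consequence `exists_isogeny_degree_le_163`), NOT proved in the
   tree (Mazur 1978, Thm. 1; Kenku 1982);
2. **Faltings' Lemma 5** for the height `h(E/ℚ)` of the Néron model over `ℤ`
   (Faltings 1983, §4 "Isogenies", Lemma 5, p. 87 of the translation:
   `h(A₂) = h(A₁) + ½ log deg φ − [K:ℚ]⁻¹ log #s^*Ω¹_{G/R}`, printed for semiabelian models; for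
   the height `h(E/ℚ)` of Pasten §3 the same computation is run with the Néron models over `ℤ`,
   which is how Pasten applies it): for a `ℚ`-isogeny `φ : E → E'` between global minimal
   models with Néron lattices `Λ, Λ'`,
   * (archimedean) `φ` is `z ↦ qz` on `ℂ/Λ → ℂ/Λ'` with `q ∈ ℚˣ`, `qΛ ⊆ Λ'`, `[Λ' : qΛ] = deg φ`
     (Silverman, *AEC*, Thm. VI.4.1(b) and III.5) — PROVED in the tree over any number field
     (`WeierstrassCurve.Isogeny.exists_multiplier_of_isShort`, `IsogenyPeriodLatticeProofs`) and
     specialised to `ℚ` here (`exists_rat_mulLeft_lattice_le_of_isogeny`); hence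
     `q² covol(Λ) = deg φ · covol(Λ')`, i.e. `h(E') = h(E) + ½ log deg φ − log|q|`;
   * (finite) **`q ∈ ℤ`**: `φ^*ω_{E'} = q ω_E` for the Néron differentials, and `φ` extends to the
     Néron models (Néron mapping property, Silverman *ATAEC* IV.5.1, with IV.6.3: the smooth part
     of a minimal Weierstrass model is the identity component of the Néron model), so `q ω_E` is an
     invariant differential of the Néron model of `E` over `ℤ`, an integral multiple of `ω_E`. This
     is the term `#(ω/φ^*ω') ≥ 1` of Faltings' proof; it is NOT proved in the tree (no Néron models
     attached to the tree's point-set isogenies, no reduction theory of isogenies at finite places;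
     cf. the same gap for the stable height in `FaltingsHeightIsogenyReductionProofs`) and enters
     below as an explicit hypothesis schema (`hN`, "integral Néron multipliers"), not as a named
     fact.
   Given `|q| ≥ 1` for `φ` and for its dual `φ̂` (`φ̂ ∘ φ = [deg φ]`, `deg φ̂ = deg φ`, Silverman
   *AEC* III.6.1–6.2, the tree's `Isogeny.exists_dual_of_isElliptic`,
   `Isogeny.degree_eq_of_comp_eq_degree_smul`): `|h(E) − h(E')| ≤ ½ log deg φ`.
3. Glue: `deg φ ≤ 163` and monotonicity of `log`.

Proved here, unconditionally:
* `neronLatticeHeight_le_of_mulLeft_lattice_le` — lattice form of Faltings' computation: if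
  `cΛ ⊆ Λ'` has index `n` and `‖c‖ ≥ 1` then `h(Λ') ≤ h(Λ) + ½ log n` (`h = −½ log covol`);
* `exists_rat_mulLeft_lattice_le_of_isogeny` — for elliptic `W, W'` over `ℚ` (any models) with
  Néron-type period pairs `L, L'` and a `ℚ`-isogeny `φ : W → W'`: `∃ q ∈ ℚˣ`, `qΛ_L ⊆ Λ_{L'}`,
  `[Λ_{L'} : qΛ_L] = deg φ` (the case `K = ℚ`, `σ = (ℚ → ℂ)` of `exists_multiplier_of_isShort`,
  after passing to short models by changes of variables with `u = 1`).
Proved here, from the hypothesis schema `hN` (integral Néron multipliers):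
* `neronLatticeHeight_le_add_half_log_degree` — `h(E') ≤ h(E) + ½ log deg φ` (Faltings' Lemma 5
  for `h(E/ℚ)`); `abs_neronLatticeHeight_sub_le_half_log_degree` — the two-sided form;
* `abs_neronLatticeHeight_sub_le_of_isIsogenous_of_mazurKenku` — **the named fact follows from
  `mazurKenku_exists_cyclic_isogeny` and `hN`** (Pasten's proof, verbatim).
Conversely (appended): `exists_int_sq_mul_covolume_eq_degree_mul` (`a² covol(Λ) = deg φ covol(Λ')`
for the integral multiplier) and `degree_le_163_of_prime_degree` — granted `hN`, the named fact
implies that every `ℚ`-isogeny of prime degree `p` between elliptic curves over `ℚ` has `p ≤ 163`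
(for such `φ` one has `|h(E) − h(E')| = ½ log p` exactly), i.e. the prime-degree case of the
Mazur–Kenku input: the fact is not available more cheaply than Mazur's theorem.

Not here: proofs of Mazur–Kenku and of the integrality of Néron multipliers (the two inputs under
which the fact is closed); the stable-height version (see `FaltingsHeightIsogenyDualProofs`).
No statement of the tree is changed; no definition or named fact is introduced.

Appended (work item `wi-32038`): the hypothesis schema `hN` IS (a special case of) the tree's named
fact `Literature.NumberTheory.EllipticCurves.integral_neronScaling_of_isGloballyMinimal`
(`NeronIsogenyScaling.lean`, Silverman *ATAEC* IV.5.1, IV.6.1, Cor. IV.9.1: `qΛ₀ ⊆ Λ'` for the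
Néron lattices of globally minimal models forces `q ∈ ℤ`; no isogeny or index needed) —
`integralNeronMultipliers_of_integral_neronScaling` — so that Faltings' Lemma 5 for `h(E/ℚ)` and
its corollaries become theorems CONDITIONAL ON THAT ONE NAMED FACT:
`neronLatticeHeight_le_add_half_log_degree_of_integral_neronScaling` (`h(E') ≤ h(E) + ½ log deg φ`),
`abs_neronLatticeHeight_sub_le_half_log_degree_of_integral_neronScaling` (two-sided),
`abs_neronLatticeHeight_sub_le_half_log_of_degree_le_of_integral_neronScaling` (any real bound
`deg φ ≤ B`, the form consumed by isogeny-radius statements such as crux `IsogenyDegreeBound` of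
route `ABC/RibetTakahashiSplit`), the covolume forms `covol(Λ) ≤ deg φ · covol(Λ')`,
`covol(Λ') ≤ deg φ · covol(Λ)` (`covolume_le_degree_mul_covolume_of_integral_neronScaling`,
`covolume_le_degree_mul_covolume_of_integral_neronScaling'`), and the named fact
`abs_neronLatticeHeight_sub_le_of_isIsogenous` from `mazurKenku_exists_cyclic_isogeny` and
`integral_neronScaling_of_isGloballyMinimal`
(`abs_neronLatticeHeight_sub_le_of_isIsogenous_of_mazurKenku_of_integral_neronScaling`).

## References

* [PastenShimura2024] H. Pasten, *Shimura curves and the abc conjecture*, J. Number Theory 254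
  (2024) = arXiv:1705.09251: §3 p. 13, Lemma 6.8 (proof).
* [Faltings1986FinitenessTranslation] G. Faltings, *Finiteness theorems for abelian varieties
  over number fields*, in Cornell–Silverman, *Arithmetic Geometry*, Ch. II, §4 (Isogenies),
  Lemma 5 (p. 87) and the Remark following it.
* [SilvermanAEC2009] J. H. Silverman, *The Arithmetic of Elliptic Curves*, 2nd ed.: III.5,
  Thm. III.6.1(a), Thm. III.6.2(e), Thm. VI.4.1(b), IX.6 Example 6.4 (Mazur–Kenku).
* [SilvermanATAEC1994] J. H. Silverman, *Advanced Topics in the Arithmetic of Elliptic Curves*,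
  IV.5.1 (Néron mapping property), IV.6.3.
-/

noncomputable section

open scoped Classical

namespace Literature.NumberTheory.EllipticCurves.ModularForms

-- `_root_`: the import closure now contains `Literature.NumberTheory.EllipticCurves.WeierstrassCurve.Affine`
-- (ReductionHomomorphism / LocalDenominatorLaw), which shadowed Mathlib's namespace here and broke
-- the full build 2026-08-16 (`Isogeny`, `VariableChange` unresolved); CONVENTIONS §2.
open _root_.WeierstrassCurve

/-! ### Faltings' computation, lattice form -/

/-- **Faltings' Lemma 5, lattice form.** If `c ≠ 0`, `cΛ_L ⊆ Λ_{L'}` with index `n` and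
`‖c‖ ≥ 1`, then `h(L') ≤ h(L) + ½ log n` for `h = neronLatticeHeight = −½ log covol`: indeed
`covol(cΛ) = ‖c‖² covol(Λ)` (the tree's `PeriodPair.covolume_mulLeft_lattice`) and
`covol(cΛ) = [Λ' : cΛ] covol(Λ')` (Mathlib `ZLattice.covolume_div_covolume_eq_relIndex'`), so
`covol(Λ) ≤ ‖c‖² covol(Λ) = n covol(Λ')`. For the isogeny `z ↦ cz : ℂ/Λ → ℂ/Λ'` of degree `n`
this is `h(E') = h(E) + ½ log n − log ‖c‖` (Faltings 1983, §4, proof of Lemma 5, the term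
`log #(ω/φ^*ω')` being `log ‖c‖ ≥ 0`). [cite: Faltings1986FinitenessTranslation, §4 Lemma 5 (proof, p. 87)] -/
theorem neronLatticeHeight_le_of_mulLeft_lattice_le {L L' : PeriodPair} {c : ℂ} (hc : c ≠ 0)
    (h1 : 1 ≤ ‖c‖) (hle : (L.mulLeft c hc).lattice ≤ L'.lattice) {n : ℕ}
    (hidx : (L.mulLeft c hc).lattice.toAddSubgroup.relIndex L'.lattice.toAddSubgroup = n) :
    neronLatticeHeight L' ≤ neronLatticeHeight L + 1 / 2 * Real.log n := by
  have hpos : 0 < ZLattice.covolume L.lattice := ZLattice.covolume_pos _ _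
  have hpos' : 0 < ZLattice.covolume L'.lattice := ZLattice.covolume_pos _ _
  have hcov := ZLattice.covolume_div_covolume_eq_relIndex' (L.mulLeft c hc).lattice L'.lattice hle
  rw [hidx, L.covolume_mulLeft_lattice c hc, div_eq_iff hpos'.ne'] at hcov
  -- `hcov : ‖c‖ ^ 2 * covol Λ = n * covol Λ'`
  have hc2 : 1 ≤ ‖c‖ ^ 2 := one_le_pow₀ h1
  have hkey : ZLattice.covolume L.lattice ≤ (n : ℝ) * ZLattice.covolume L'.lattice := by
    rw [← hcov]
    nlinarith
  have hn : (0 : ℝ) < n := by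
    rcases Nat.eq_zero_or_pos n with h0 | h0
    · rw [h0, Nat.cast_zero, zero_mul] at hkey
      exact absurd hkey (not_le.mpr hpos)
    · exact_mod_cast h0
  have hlog : Real.log (ZLattice.covolume L.lattice) ≤
      Real.log n + Real.log (ZLattice.covolume L'.lattice) := by
    rw [← Real.log_mul hn.ne' hpos'.ne']
    exact Real.log_le_log hpos hkey
  rw [neronLatticeHeight, neronLatticeHeight]
  linarith

/-! ### The multiplier of a `ℚ`-isogeny on the period lattices -/

/-- **A `ℚ`-isogeny acts on the period lattices as `z ↦ qz` with `q ∈ ℚˣ` and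
`[Λ' : qΛ] = deg φ`.** For elliptic curves `W, W'` over `ℚ` (any Weierstrass models) with
Néron-type period pairs `L, L'` (`IsNeronLatticeOf`: `g₂ = c₄/12`, `g₃ = c₆/216`, the period
lattices of `dx/(2y + a₁x + a₃)`) and an isogeny `φ : W → W'` defined over `ℚ`, there is a
non-zero rational `q` with `qΛ_L ⊆ Λ_{L'}` and `[Λ_{L'} : qΛ_L] = deg φ` (`= #ker φ`). This is the
case `K = ℚ`, `σ = (ℚ → ℂ)` of the tree's `WeierstrassCurve.Isogeny.exists_multiplier_of_isShort`
(Silverman, *AEC*, Thm. VI.4.1(b): the isogeny is `z ↦ qz`; III.5: `q = φ^*ω'/ω ∈ ℚ`), applied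
after the changes of variables `(1, −b₂/12, −a₁/2, a₁b₂/24 − a₃/2)` to short models, which have
`u = 1` and hence the same `c₄, c₆`, the same period lattices and the same degree
(`Isogeny.exists_degree_eq_of_smul`). It refines the tree's
`neronLattice_commensurable_of_isIsogenous_holds` (`aΛ ⊆ Λ'`, no index) by the index.
[cite: SilvermanAEC2009, Thm. VI.4.1(b) (PDF pp. 152–154) and III.5 (PDF p. 75)] -/
theorem exists_rat_mulLeft_lattice_le_of_isogeny (W W' : WeierstrassCurve ℚ) [W.IsElliptic]
    [W'.IsElliptic] {L L' : PeriodPair} (hL : IsNeronLatticeOf (W.baseChange ℂ) L)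
    (hL' : IsNeronLatticeOf (W'.baseChange ℂ) L') (φ : Isogeny W W') :
    ∃ (q : ℚ) (hq : ((q : ℚ) : ℂ) ≠ 0), (L.mulLeft (q : ℂ) hq).lattice ≤ L'.lattice ∧
      (L.mulLeft (q : ℂ) hq).lattice.toAddSubgroup.relIndex L'.lattice.toAddSubgroup =
        φ.degree := by
  classical
  haveI : Invertible (2 : ℚ) := invertibleOfNonzero two_ne_zero
  haveI : Invertible (3 : ℚ) := invertibleOfNonzero three_ne_zero
  set C : VariableChange ℚ := ⟨1, -W.b₂ / 12, -W.a₁ / 2, W.a₁ * W.b₂ / 24 - W.a₃ / 2⟩ with hC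
  set C' : VariableChange ℚ := ⟨1, -W'.b₂ / 12, -W'.a₁ / 2, W'.a₁ * W'.b₂ / 24 - W'.a₃ / 2⟩
    with hC'
  obtain ⟨h₁, h₂, h₃⟩ := Isogeny.shortChange_a₁_a₂_a₃ W
  obtain ⟨h₁', h₂', h₃'⟩ := Isogeny.shortChange_a₁_a₂_a₃ W'
  obtain ⟨ψ, hψ⟩ := Isogeny.exists_degree_eq_of_smul φ C C'
  obtain ⟨α₀, -, -, han⟩ := Isogeny.exists_multiplier_of_isShort ψ h₁ h₂ h₃ h₁' h₂' h₃'
  -- the short models have the same `c₄, c₆` (`u = 1`)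
  have hu : ∀ (V : WeierstrassCurve ℚ) (D : VariableChange ℚ), D.u = 1 →
      ((D • V).map (algebraMap ℚ ℂ)).c₄ = (V.baseChange ℂ).c₄ ∧
        ((D • V).map (algebraMap ℚ ℂ)).c₆ = (V.baseChange ℂ).c₆ := by
    intro V D hD
    rw [← map_variableChange, variableChange_c₄, variableChange_c₆, VariableChange.map_u, hD]
    simp only [map_one, inv_one, Units.val_one, one_pow, one_mul]
    exact ⟨rfl, rfl⟩
  obtain ⟨hc₄, hc₆⟩ := hu W C rfl
  obtain ⟨hc₄', hc₆'⟩ := hu W' C' rfl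
  obtain ⟨hσ, hle, hidx⟩ := han (algebraMap ℚ ℂ) L L' (by rw [hc₄]; exact hL.1)
    (by rw [hc₆]; exact hL.2) (by rw [hc₄']; exact hL'.1) (by rw [hc₆']; exact hL'.2)
  have hcast : (algebraMap ℚ ℂ) α₀ = ((α₀ : ℚ) : ℂ) := eq_ratCast _ _
  have key : ∀ (c : ℂ) (hc : c ≠ 0), c = (algebraMap ℚ ℂ) α₀ →
      (L.mulLeft c hc).lattice ≤ L'.lattice ∧
        (L.mulLeft c hc).lattice.toAddSubgroup.relIndex L'.lattice.toAddSubgroup = φ.degree := by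
    rintro c hc rfl
    exact ⟨hle, hψ ▸ hidx⟩
  exact ⟨α₀, by rw [← hcast]; exact hσ, key _ _ hcast.symm⟩

/-! ### Faltings' Lemma 5 for `h(E/ℚ)`, from the integrality of Néron multipliers -/

/-- **Faltings' Lemma 5 for `h(E/ℚ)`: `h(E') ≤ h(E) + ½ log deg φ`**, for global minimal models
`W, W'` over `ℚ` with Néron lattices `L, L'` (`h = neronLatticeHeight = −½ log covol`, Pasten
2024 §3) and a `ℚ`-isogeny `φ : W → W'` — from the hypothesis schema `hN` (**integral Néron
multipliers**): whenever a rational `q` satisfies `qΛ_E ⊆ Λ_{E'}` with `[Λ_{E'} : qΛ_E] = deg φ`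
for the Néron lattices of global minimal models and a `ℚ`-isogeny `φ`, `q` is an integer. (Such
`q` is `± φ^*ω_{E'}/ω_E` for the Néron differentials, and its integrality is the Néron mapping
property, Silverman *ATAEC* IV.5.1 with IV.6.3 — the term `#(ω/φ^*ω') ≥ 1` in Faltings' proof; it
is not proved in the tree.) Proof: `exists_rat_mulLeft_lattice_le_of_isogeny` gives `q`, `hN`
gives `|q| ≥ 1`, and `neronLatticeHeight_le_of_mulLeft_lattice_le` concludes.
[cite: Faltings1986FinitenessTranslation, §4 Lemma 5 (p. 87)] -/
theorem neronLatticeHeight_le_add_half_log_degree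
    (hN : ∀ (W W' : WeierstrassCurve ℚ) [W.IsElliptic] [W'.IsElliptic] [W.IsGloballyMinimal]
      [W'.IsGloballyMinimal] (L L' : PeriodPair), IsNeronLatticeOf (W.baseChange ℂ) L →
      IsNeronLatticeOf (W'.baseChange ℂ) L' → ∀ (φ : Isogeny W W') (q : ℚ)
      (hq : ((q : ℚ) : ℂ) ≠ 0), (L.mulLeft (q : ℂ) hq).lattice ≤ L'.lattice →
      (L.mulLeft (q : ℂ) hq).lattice.toAddSubgroup.relIndex L'.lattice.toAddSubgroup = φ.degree →
      ∃ a : ℤ, (a : ℚ) = q)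
    (W W' : WeierstrassCurve ℚ) [W.IsElliptic] [W'.IsElliptic] [W.IsGloballyMinimal]
    [W'.IsGloballyMinimal] {L L' : PeriodPair} (hL : IsNeronLatticeOf (W.baseChange ℂ) L)
    (hL' : IsNeronLatticeOf (W'.baseChange ℂ) L') (φ : Isogeny W W') :
    neronLatticeHeight L' ≤ neronLatticeHeight L + 1 / 2 * Real.log φ.degree := by
  obtain ⟨q, hq, hle, hidx⟩ := exists_rat_mulLeft_lattice_le_of_isogeny W W' hL hL' φ
  obtain ⟨a, ha⟩ := hN W W' L L' hL hL' φ q hq hle hidx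
  have ha0 : a ≠ 0 := by
    rintro rfl
    apply hq
    rw [← ha]
    simp
  have h1 : 1 ≤ ‖((q : ℚ) : ℂ)‖ := by
    rw [← ha, Rat.cast_intCast, Complex.norm_intCast]
    exact_mod_cast Int.one_le_abs ha0
  exact neronLatticeHeight_le_of_mulLeft_lattice_le hq h1 hle hidx

/-- **`|h(E) − h(E')| ≤ ½ log deg φ`** for global minimal models `W, W'` over `ℚ` with Néron
lattices `L, L'` and a `ℚ`-isogeny `φ : W → W'`, from the integral-Néron-multiplier hypothesis
`hN` (see `neronLatticeHeight_le_add_half_log_degree`) applied to `φ` and to its dual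
`φ̂ : W' → W` (`φ̂ ∘ φ = [deg φ]`, the tree's `Isogeny.exists_dual_of_isElliptic`, Silverman
*AEC* III.6.1(a); `deg φ̂ = deg φ`, `Isogeny.degree_eq_of_comp_eq_degree_smul`, III.6.2(e)).
Faltings 1983, §4, Lemma 5 and the Remark following it; the form quoted by Pasten 2024, §3.
[cite: Faltings1986FinitenessTranslation, §4 Lemma 5 and Remark (p. 87)] -/
theorem abs_neronLatticeHeight_sub_le_half_log_degree
    (hN : ∀ (W W' : WeierstrassCurve ℚ) [W.IsElliptic] [W'.IsElliptic] [W.IsGloballyMinimal]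
      [W'.IsGloballyMinimal] (L L' : PeriodPair), IsNeronLatticeOf (W.baseChange ℂ) L →
      IsNeronLatticeOf (W'.baseChange ℂ) L' → ∀ (φ : Isogeny W W') (q : ℚ)
      (hq : ((q : ℚ) : ℂ) ≠ 0), (L.mulLeft (q : ℂ) hq).lattice ≤ L'.lattice →
      (L.mulLeft (q : ℂ) hq).lattice.toAddSubgroup.relIndex L'.lattice.toAddSubgroup = φ.degree →
      ∃ a : ℤ, (a : ℚ) = q)
    (W W' : WeierstrassCurve ℚ) [W.IsElliptic] [W'.IsElliptic] [W.IsGloballyMinimal]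
    [W'.IsGloballyMinimal] {L L' : PeriodPair} (hL : IsNeronLatticeOf (W.baseChange ℂ) L)
    (hL' : IsNeronLatticeOf (W'.baseChange ℂ) L') (φ : Isogeny W W') :
    |neronLatticeHeight L - neronLatticeHeight L'| ≤ 1 / 2 * Real.log φ.degree := by
  have h₁ := neronLatticeHeight_le_add_half_log_degree hN W W' hL hL' φ
  obtain ⟨ψ, hψ⟩ := φ.exists_dual_of_isElliptic
  have hdeg : ψ.degree = φ.degree := Isogeny.degree_eq_of_comp_eq_degree_smul φ ψ hψ
  have h₂ := neronLatticeHeight_le_add_half_log_degree hN W' W hL' hL ψ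
  rw [hdeg] at h₂
  rw [abs_sub_le_iff]
  constructor <;> linarith

/-! ### The named fact from Mazur–Kenku and the integrality of Néron multipliers -/

/-- **Pasten 2024, §3 p. 13 / Lemma 6.8 (proof): `|h(E) − h(E')| ≤ ½ log 163` for
`ℚ`-isogenous elliptic curves, from its two printed inputs.** "The degree of a minimal isogeny
between `A` and `E` is uniformly bounded by `163` thanks to Mazur and Kenku, so Lemma 5 in
[Faltings] gives `|h(A) − h(E)| ≤ ½ log 163`": with `hMK` the tree's named fact
`mazurKenku_exists_cyclic_isogeny` (a `ℚ`-isogeny of degree `≤ 163`,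
`exists_isogeny_degree_le_163`; Silverman *AEC* IX.6 Example 6.4) and `hN` the integrality of
Néron multipliers (the finite half of Faltings' Lemma 5 over `ℤ`, see
`neronLatticeHeight_le_add_half_log_degree`), the named fact
`abs_neronLatticeHeight_sub_le_of_isIsogenous` holds:
`|h − h'| ≤ ½ log deg φ ≤ ½ log 163`. This is the whole of the printed proof; the fact stays a
named fact until `hMK` and `hN` are theorems of the tree.
[cite: PastenShimura2024, §3 p. 13 and Lemma 6.8 (proof)] -/
theorem abs_neronLatticeHeight_sub_le_of_isIsogenous_of_mazurKenku
    (hMK : mazurKenku_exists_cyclic_isogeny)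
    (hN : ∀ (W W' : WeierstrassCurve ℚ) [W.IsElliptic] [W'.IsElliptic] [W.IsGloballyMinimal]
      [W'.IsGloballyMinimal] (L L' : PeriodPair), IsNeronLatticeOf (W.baseChange ℂ) L →
      IsNeronLatticeOf (W'.baseChange ℂ) L' → ∀ (φ : Isogeny W W') (q : ℚ)
      (hq : ((q : ℚ) : ℂ) ≠ 0), (L.mulLeft (q : ℂ) hq).lattice ≤ L'.lattice →
      (L.mulLeft (q : ℂ) hq).lattice.toAddSubgroup.relIndex L'.lattice.toAddSubgroup = φ.degree →
      ∃ a : ℤ, (a : ℚ) = q) :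
    abs_neronLatticeHeight_sub_le_of_isIsogenous := by
  intro W W' _ _ _ _ L L' hL hL' hiso
  obtain ⟨φ, hφ⟩ := exists_isogeny_degree_le_163 hMK W W' hiso
  have h := abs_neronLatticeHeight_sub_le_half_log_degree hN W W' hL hL' φ
  have hdeg0 : (0 : ℝ) < φ.degree := by exact_mod_cast φ.degree_pos
  have hlog : Real.log φ.degree ≤ Real.log 163 :=
    Real.log_le_log hdeg0 (by exact_mod_cast hφ)
  linarith

/-! ### Conversely: with integral Néron multipliers, the fact bounds prime isogeny degrees -/

/-- **An integral multiplier squares to `deg φ · covol(Λ')/covol(Λ)`.** Under the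
integral-Néron-multiplier hypothesis `hN` (see `neronLatticeHeight_le_add_half_log_degree`), a
`ℚ`-isogeny `φ : W → W'` between global minimal models with Néron lattices `L, L'` has an
integer `a ≠ 0` with `a² · covol(Λ_L) = deg φ · covol(Λ_{L'})` (`a = ± φ^*ω'/ω`;
`exists_rat_mulLeft_lattice_le_of_isogeny` with `covol(aΛ) = a² covol(Λ) = [Λ' : aΛ] covol(Λ')`).
This is the exact form `h(E') = h(E) + ½ log deg φ − log|a|` of Faltings' Lemma 5 for `h(E/ℚ)`.
[cite: Faltings1986FinitenessTranslation, §4 Lemma 5 (p. 87)] -/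
theorem exists_int_sq_mul_covolume_eq_degree_mul
    (hN : ∀ (W W' : WeierstrassCurve ℚ) [W.IsElliptic] [W'.IsElliptic] [W.IsGloballyMinimal]
      [W'.IsGloballyMinimal] (L L' : PeriodPair), IsNeronLatticeOf (W.baseChange ℂ) L →
      IsNeronLatticeOf (W'.baseChange ℂ) L' → ∀ (φ : Isogeny W W') (q : ℚ)
      (hq : ((q : ℚ) : ℂ) ≠ 0), (L.mulLeft (q : ℂ) hq).lattice ≤ L'.lattice →
      (L.mulLeft (q : ℂ) hq).lattice.toAddSubgroup.relIndex L'.lattice.toAddSubgroup = φ.degree →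
      ∃ a : ℤ, (a : ℚ) = q)
    (W W' : WeierstrassCurve ℚ) [W.IsElliptic] [W'.IsElliptic] [W.IsGloballyMinimal]
    [W'.IsGloballyMinimal] {L L' : PeriodPair} (hL : IsNeronLatticeOf (W.baseChange ℂ) L)
    (hL' : IsNeronLatticeOf (W'.baseChange ℂ) L') (φ : Isogeny W W') :
    ∃ a : ℤ, a ≠ 0 ∧
      (a : ℝ) ^ 2 * ZLattice.covolume L.lattice = φ.degree * ZLattice.covolume L'.lattice := by
  obtain ⟨q, hq, hle, hidx⟩ := exists_rat_mulLeft_lattice_le_of_isogeny W W' hL hL' φ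
  obtain ⟨a, ha⟩ := hN W W' L L' hL hL' φ q hq hle hidx
  have ha0 : a ≠ 0 := by
    rintro rfl
    apply hq
    rw [← ha]
    simp
  have hpos' : 0 < ZLattice.covolume L'.lattice := ZLattice.covolume_pos _ _
  have hcov := ZLattice.covolume_div_covolume_eq_relIndex' (L.mulLeft (q : ℂ) hq).lattice
    L'.lattice hle
  rw [hidx, L.covolume_mulLeft_lattice (q : ℂ) hq, div_eq_iff hpos'.ne', ← ha, Rat.cast_intCast,
    Complex.norm_intCast, sq_abs] at hcov
  exact ⟨a, ha0, hcov⟩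

/-- **With integral Néron multipliers, the fact gives back Mazur's bound on prime isogeny
degrees.** Assume the named fact `abs_neronLatticeHeight_sub_le_of_isIsogenous` (`hT`) and the
integral-Néron-multiplier hypothesis `hN`. If `φ : W → W'` is a `ℚ`-isogeny of PRIME degree `p`
between global minimal models (with Néron lattices `L, L'`), then `p ≤ 163`: the integral
multipliers `a` of `φ` and `b` of its dual satisfy `a² covol(Λ) = p covol(Λ')`,
`b² covol(Λ') = p covol(Λ)`, so `|ab| = p` and `{|a|, |b|} = {1, p}`, whence
`|h(E) − h(E')| = ½ log p` exactly, and `hT` gives `½ log p ≤ ½ log 163`. So, granted `hN`, the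
fact is as strong as the prime-degree case of the Mazur–Kenku theorem it is proved from (Mazur
1978, Thm. 1: no rational `p`-isogeny for `p > 163`) — it cannot be had more cheaply. [folklore] -/
theorem degree_le_163_of_prime_degree (hT : abs_neronLatticeHeight_sub_le_of_isIsogenous)
    (hN : ∀ (W W' : WeierstrassCurve ℚ) [W.IsElliptic] [W'.IsElliptic] [W.IsGloballyMinimal]
      [W'.IsGloballyMinimal] (L L' : PeriodPair), IsNeronLatticeOf (W.baseChange ℂ) L →
      IsNeronLatticeOf (W'.baseChange ℂ) L' → ∀ (φ : Isogeny W W') (q : ℚ)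
      (hq : ((q : ℚ) : ℂ) ≠ 0), (L.mulLeft (q : ℂ) hq).lattice ≤ L'.lattice →
      (L.mulLeft (q : ℂ) hq).lattice.toAddSubgroup.relIndex L'.lattice.toAddSubgroup = φ.degree →
      ∃ a : ℤ, (a : ℚ) = q)
    (W W' : WeierstrassCurve ℚ) [W.IsElliptic] [W'.IsElliptic] [W.IsGloballyMinimal]
    [W'.IsGloballyMinimal] {L L' : PeriodPair} (hL : IsNeronLatticeOf (W.baseChange ℂ) L)
    (hL' : IsNeronLatticeOf (W'.baseChange ℂ) L') (φ : Isogeny W W') (hp : φ.degree.Prime) :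
    φ.degree ≤ 163 := by
  set p : ℕ := φ.degree with hpdef
  have hcL : 0 < ZLattice.covolume L.lattice := ZLattice.covolume_pos _ _
  have hcL' : 0 < ZLattice.covolume L'.lattice := ZLattice.covolume_pos _ _
  -- integral multipliers of `φ` and of its dual
  obtain ⟨a, ha0, ha⟩ := exists_int_sq_mul_covolume_eq_degree_mul hN W W' hL hL' φ
  obtain ⟨ψ, hψ⟩ := φ.exists_dual_of_isElliptic
  have hdeg : ψ.degree = φ.degree := Isogeny.degree_eq_of_comp_eq_degree_smul φ ψ hψ
  obtain ⟨b, hb0, hb⟩ := exists_int_sq_mul_covolume_eq_degree_mul hN W' W hL' hL ψ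
  rw [hdeg] at hb
  rw [← hpdef] at ha hb
  -- `(ab)² = p²`, hence `|a| · |b| = p` and `|a| ∈ {1, p}`
  have hab : ((a * b : ℤ) : ℝ) ^ 2 = ((p : ℤ) : ℝ) ^ 2 := by
    have h1 : ((a : ℝ) ^ 2 * ZLattice.covolume L.lattice) * ((b : ℝ) ^ 2 *
        ZLattice.covolume L'.lattice) =
        ((p : ℝ) * ZLattice.covolume L'.lattice) * ((p : ℝ) * ZLattice.covolume L.lattice) := by
      rw [ha, hb]
    have h2 : (((a : ℝ) * b) ^ 2 - (p : ℝ) ^ 2) *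
        (ZLattice.covolume L.lattice * ZLattice.covolume L'.lattice) = 0 := by
      linear_combination h1
    rcases mul_eq_zero.mp h2 with h3 | h3
    · push_cast
      linarith
    · exact absurd h3 (mul_pos hcL hcL').ne'
  have hab' : (a * b).natAbs = (p : ℤ).natAbs :=
    Int.natAbs_eq_iff_sq_eq.mpr (by exact_mod_cast hab)
  rw [Int.natAbs_mul, Int.natAbs_natCast] at hab'
  have ha1p : a.natAbs = 1 ∨ a.natAbs = p := hp.eq_one_or_self_of_dvd a.natAbs ⟨b.natAbs, hab'.symm⟩
  have hasq : (a : ℝ) ^ 2 = ((a.natAbs : ℕ) : ℝ) ^ 2 := by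
    rw [Nat.cast_natAbs, Int.cast_abs, sq_abs]
  have hp0 : (0 : ℝ) < p := by exact_mod_cast hp.pos
  -- in either case `|h(L) − h(L')| = ½ log p`
  have hkey : 1 / 2 * Real.log p ≤ |neronLatticeHeight L - neronLatticeHeight L'| := by
    rw [neronLatticeHeight, neronLatticeHeight]
    rcases ha1p with h1 | h1
    · -- `covol L = p · covol L'`
      rw [hasq, h1, Nat.cast_one, one_pow, one_mul] at ha
      have hlog : Real.log (ZLattice.covolume L.lattice) =
          Real.log p + Real.log (ZLattice.covolume L'.lattice) := by
        rw [ha, Real.log_mul hp0.ne' hcL'.ne']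
      have hlp : 0 ≤ Real.log p := Real.log_nonneg (by exact_mod_cast hp.one_le)
      rw [hlog, abs_of_nonpos (by linarith)]
      linarith
    · -- `p · covol L = covol L'`
      rw [hasq, h1] at ha
      have ha' : (p : ℝ) * ZLattice.covolume L.lattice = ZLattice.covolume L'.lattice := by
        have : (p : ℝ) *
            ((p : ℝ) * ZLattice.covolume L.lattice - ZLattice.covolume L'.lattice) = 0 := by
          linear_combination ha
        rcases mul_eq_zero.mp this with h | h
        · exact absurd h hp0.ne'
        · linarith
      have hlog : Real.log (ZLattice.covolume L'.lattice) =
          Real.log p + Real.log (ZLattice.covolume L.lattice) := by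
        rw [← ha', Real.log_mul hp0.ne' hcL.ne']
      have hlp : 0 ≤ Real.log p := Real.log_nonneg (by exact_mod_cast hp.one_le)
      rw [hlog, abs_of_nonneg (by linarith)]
      linarith
  have hT' := hT W W' L L' hL hL' ⟨φ⟩
  have hlog : Real.log p ≤ Real.log 163 := by linarith
  have : (p : ℝ) ≤ 163 := (Real.log_le_log_iff hp0 (by norm_num)).mp hlog
  exact_mod_cast this

/-! ### The hypothesis schema `hN` is the named fact `integral_neronScaling_of_isGloballyMinimal` -/

/-- **Integral Néron multipliers, from the named fact.** The hypothesis schema `hN` of this file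
(whenever `q ∈ ℚ` satisfies `qΛ_E ⊆ Λ_{E'}` with `[Λ_{E'} : qΛ_E] = deg φ` for the Néron lattices of
global minimal models and a `ℚ`-isogeny `φ`, `q ∈ ℤ`) is a special case of the tree's named fact
`Literature.NumberTheory.EllipticCurves.integral_neronScaling_of_isGloballyMinimal`
(`NeronIsogenyScaling.lean`: `qΛ₀ ⊆ Λ'` alone forces `q ∈ ℤ` — Néron mapping property, Silverman
*ATAEC* IV.5.1 with IV.6.1 and Cor. IV.9.1), since `qz ∈ qΛ_E ⊆ Λ_{E'}` for `z ∈ Λ_E`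
(`PeriodPair.mul_mem_mulLeft_lattice`); neither the isogeny nor the index is needed.
[cite: SilvermanATAEC1994, IV.5.1 (Néron mapping property) with IV.6.1 and Cor. IV.9.1] -/
theorem integralNeronMultipliers_of_integral_neronScaling
    (h : integral_neronScaling_of_isGloballyMinimal) :
    ∀ (W W' : WeierstrassCurve ℚ) [W.IsElliptic] [W'.IsElliptic] [W.IsGloballyMinimal]
      [W'.IsGloballyMinimal] (L L' : PeriodPair), IsNeronLatticeOf (W.baseChange ℂ) L →
      IsNeronLatticeOf (W'.baseChange ℂ) L' → ∀ (φ : Isogeny W W') (q : ℚ)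
      (hq : ((q : ℚ) : ℂ) ≠ 0), (L.mulLeft (q : ℂ) hq).lattice ≤ L'.lattice →
      (L.mulLeft (q : ℂ) hq).lattice.toAddSubgroup.relIndex L'.lattice.toAddSubgroup = φ.degree →
      ∃ a : ℤ, (a : ℚ) = q := by
  intro W W' _ _ _ _ L L' hL hL' _ q hq hle _
  exact h W W' L L' hL hL' q fun z hz ↦ hle (PeriodPair.mul_mem_mulLeft_lattice.mpr hz)

/-! ### Faltings' Lemma 5 for `h(E/ℚ)` and its corollaries, conditional on the named fact only -/

/-- **Faltings' Lemma 5 for `h(E/ℚ)`, from the named fact `integral_neronScaling_of_isGloballyMinimal`: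
`h(E') ≤ h(E) + ½ log deg φ`** for global minimal models `W, W'` over `ℚ` with Néron lattices
`L, L'` (`h = neronLatticeHeight = −½ log covol`) and a `ℚ`-isogeny `φ : W → W'`. Printed:
`h(A₂) = h(A₁) + ½ log deg φ − [K:ℚ]⁻¹ log #s^*(Ω¹_{G/R})` (Faltings, §4 Lemma 5, p. 87, for
semiabelian models over `R`; here the Néron models over `ℤ`, as applied by Pasten 2024 §3 p. 13),
whose last term is `≤ 0`; the archimedean half is the tree's
`exists_rat_mulLeft_lattice_le_of_isogeny`, the finite half (`#(ω/φ^*ω') ≥ 1`) is the named fact.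
[cite: Faltings1986FinitenessTranslation, §4 Lemma 5 (p. 87)] -/
theorem neronLatticeHeight_le_add_half_log_degree_of_integral_neronScaling
    (h : integral_neronScaling_of_isGloballyMinimal) (W W' : WeierstrassCurve ℚ) [W.IsElliptic]
    [W'.IsElliptic] [W.IsGloballyMinimal] [W'.IsGloballyMinimal] {L L' : PeriodPair}
    (hL : IsNeronLatticeOf (W.baseChange ℂ) L) (hL' : IsNeronLatticeOf (W'.baseChange ℂ) L')
    (φ : Isogeny W W') :
    neronLatticeHeight L' ≤ neronLatticeHeight L + 1 / 2 * Real.log φ.degree :=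
  neronLatticeHeight_le_add_half_log_degree (integralNeronMultipliers_of_integral_neronScaling h)
    W W' hL hL' φ

/-- **`|h(E) − h(E')| ≤ ½ log deg φ`, from the named fact `integral_neronScaling_of_isGloballyMinimal`**,
for global minimal models `W, W'` over `ℚ` with Néron lattices `L, L'` and a `ℚ`-isogeny
`φ : W → W'` (Faltings' Lemma 5 for `φ` and its dual; the Remark after Lemma 5, p. 87; the form
quoted by Pasten 2024, §3 p. 13). [cite: Faltings1986FinitenessTranslation, §4 Lemma 5 and Remark (p. 87)] -/
theorem abs_neronLatticeHeight_sub_le_half_log_degree_of_integral_neronScaling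
    (h : integral_neronScaling_of_isGloballyMinimal) (W W' : WeierstrassCurve ℚ) [W.IsElliptic]
    [W'.IsElliptic] [W.IsGloballyMinimal] [W'.IsGloballyMinimal] {L L' : PeriodPair}
    (hL : IsNeronLatticeOf (W.baseChange ℂ) L) (hL' : IsNeronLatticeOf (W'.baseChange ℂ) L')
    (φ : Isogeny W W') :
    |neronLatticeHeight L - neronLatticeHeight L'| ≤ 1 / 2 * Real.log φ.degree :=
  abs_neronLatticeHeight_sub_le_half_log_degree (integralNeronMultipliers_of_integral_neronScaling h)
    W W' hL hL' φ

/-- **Isogeny-radius form**: if the `ℚ`-isogeny `φ : W → W'` between global minimal models has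
`deg φ ≤ B` (`B` real), then `|h(E) − h(E')| ≤ ½ log B`, granted
`integral_neronScaling_of_isGloballyMinimal` — the shape in which a bound on the degree of SOME
`ℚ`-isogeny joining two isogenous curves (Mazur–Kenku's `163`, or any isogeny-radius statement)
is consumed (Pasten 2024, §3 p. 13: "so Lemma 5 in [Faltings] gives
`|h(A_{1,N}) − h(E)| ≤ ½ log 163`"). [cite: PastenShimura2024, §3 p. 13]
[cite: Faltings1986FinitenessTranslation, §4 Lemma 5 and Remark (p. 87)] -/
theorem abs_neronLatticeHeight_sub_le_half_log_of_degree_le_of_integral_neronScaling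
    (h : integral_neronScaling_of_isGloballyMinimal) (W W' : WeierstrassCurve ℚ) [W.IsElliptic]
    [W'.IsElliptic] [W.IsGloballyMinimal] [W'.IsGloballyMinimal] {L L' : PeriodPair}
    (hL : IsNeronLatticeOf (W.baseChange ℂ) L) (hL' : IsNeronLatticeOf (W'.baseChange ℂ) L')
    (φ : Isogeny W W') {B : ℝ} (hB : (φ.degree : ℝ) ≤ B) :
    |neronLatticeHeight L - neronLatticeHeight L'| ≤ 1 / 2 * Real.log B := by
  have h₁ := abs_neronLatticeHeight_sub_le_half_log_degree_of_integral_neronScaling h W W' hL hL' φ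
  have hdeg0 : (0 : ℝ) < φ.degree := by exact_mod_cast φ.degree_pos
  have hlog : Real.log φ.degree ≤ Real.log B := Real.log_le_log hdeg0 hB
  linarith

/-- **Covolume form of Faltings' Lemma 5 for `h(E/ℚ)`**: `covol(Λ_E) ≤ deg φ · covol(Λ_{E'})` for
a `ℚ`-isogeny `φ : W → W'` between global minimal models with Néron lattices `Λ_E = Λ_L`,
`Λ_{E'} = Λ_{L'}`, granted `integral_neronScaling_of_isGloballyMinimal`: the integral multiplier `a`
of `φ` has `a² covol(Λ_E) = deg φ · covol(Λ_{E'})` (`exists_int_sq_mul_covolume_eq_degree_mul`)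
and `a² ≥ 1`. (Equivalent to `h(E') ≤ h(E) + ½ log deg φ`, `h = −½ log covol`.)
[cite: Faltings1986FinitenessTranslation, §4 Lemma 5 (p. 87)] -/
theorem covolume_le_degree_mul_covolume_of_integral_neronScaling
    (h : integral_neronScaling_of_isGloballyMinimal) (W W' : WeierstrassCurve ℚ) [W.IsElliptic]
    [W'.IsElliptic] [W.IsGloballyMinimal] [W'.IsGloballyMinimal] {L L' : PeriodPair}
    (hL : IsNeronLatticeOf (W.baseChange ℂ) L) (hL' : IsNeronLatticeOf (W'.baseChange ℂ) L')
    (φ : Isogeny W W') :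
    ZLattice.covolume L.lattice ≤ φ.degree * ZLattice.covolume L'.lattice := by
  obtain ⟨a, ha0, ha⟩ := exists_int_sq_mul_covolume_eq_degree_mul
    (integralNeronMultipliers_of_integral_neronScaling h) W W' hL hL' φ
  have h1 : (1 : ℝ) ≤ (a : ℝ) ^ 2 := by
    have habs : (1 : ℝ) ≤ |(a : ℝ)| := by exact_mod_cast Int.one_le_abs ha0
    rw [← sq_abs]
    exact one_le_pow₀ habs
  have hpos : 0 < ZLattice.covolume L.lattice := ZLattice.covolume_pos _ _
  rw [← ha]
  exact le_mul_of_one_le_left hpos.le h1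

/-- **Covolume form, the other direction**: `covol(Λ_{E'}) ≤ deg φ · covol(Λ_E)` for a `ℚ`-isogeny
`φ : W → W'` between global minimal models, granted `integral_neronScaling_of_isGloballyMinimal`
(the previous bound for the dual isogeny `φ̂ : W' → W`, `deg φ̂ = deg φ`; the tree's
`Isogeny.exists_dual_of_isElliptic`, `Isogeny.degree_eq_of_comp_eq_degree_smul`, Silverman *AEC*
III.6.1(a), III.6.2(e)). [cite: Faltings1986FinitenessTranslation, §4 Lemma 5 and Remark (p. 87)] -/
theorem covolume_le_degree_mul_covolume_of_integral_neronScaling'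
    (h : integral_neronScaling_of_isGloballyMinimal) (W W' : WeierstrassCurve ℚ) [W.IsElliptic]
    [W'.IsElliptic] [W.IsGloballyMinimal] [W'.IsGloballyMinimal] {L L' : PeriodPair}
    (hL : IsNeronLatticeOf (W.baseChange ℂ) L) (hL' : IsNeronLatticeOf (W'.baseChange ℂ) L')
    (φ : Isogeny W W') :
    ZLattice.covolume L'.lattice ≤ φ.degree * ZLattice.covolume L.lattice := by
  obtain ⟨ψ, hψ⟩ := φ.exists_dual_of_isElliptic
  have hdeg : ψ.degree = φ.degree := Isogeny.degree_eq_of_comp_eq_degree_smul φ ψ hψ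
  have h₂ := covolume_le_degree_mul_covolume_of_integral_neronScaling h W' W hL' hL ψ
  rwa [hdeg] at h₂

/-- **Pasten 2024, §3 p. 13 / Lemma 6.8 (proof), from its two named inputs**: the named fact
`abs_neronLatticeHeight_sub_le_of_isIsogenous` (`|h(E) − h(E')| ≤ ½ log 163` for `ℚ`-isogenous
elliptic curves) follows from `mazurKenku_exists_cyclic_isogeny` (a `ℚ`-isogeny of degree `≤ 163`)
and `integral_neronScaling_of_isGloballyMinimal` (the finite half of Faltings' Lemma 5) — the tree's
`abs_neronLatticeHeight_sub_le_of_isIsogenous_of_mazurKenku` with its hypothesis schema `hN`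
supplied by the named fact. [cite: PastenShimura2024, §3 p. 13 and Lemma 6.8 (proof)] -/
theorem abs_neronLatticeHeight_sub_le_of_isIsogenous_of_mazurKenku_of_integral_neronScaling
    (hMK : mazurKenku_exists_cyclic_isogeny) (h : integral_neronScaling_of_isGloballyMinimal) :
    abs_neronLatticeHeight_sub_le_of_isIsogenous :=
  abs_neronLatticeHeight_sub_le_of_isIsogenous_of_mazurKenku hMK
    (integralNeronMultipliers_of_integral_neronScaling h)

end Literature.NumberTheory.EllipticCurves.ModularForms

end
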